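import Summits.QuantumFields.BalabanUV.Beta.SymAveragingHessianCountsWords
import Literature.MathematicalPhysics.QuantumFieldTheory.Balaban1983to89.Beta.AveragingWardJets

/-!
# The rooted Ward identities of the SYMMETRISED ((0.4)) pair-word functionals (node 8ρ-sym of the an1 plan)

[folklore] Kinematics only.  The (0.4)-symmetrised counts of `SymAveragingHessianCounts` (pair words `γ^{σ,σ′}_x`,
closed pair loops, `symLinCountAt` / `symHessCountAt` / `symVhCountAt`) are the instances `β = (·*·)` on `ℤ` at indicator
forms of two GENERIC second-order functionals of a biadditive pairing `β : A →+ A →+ V`, exactly as node 8ρ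
(`AveragingWardRooted`) does it for the comb words:
* §1 path Ward lemmas for the permuted comb `axialP σ` and the pair word `gammaPAt σ σ′` / pair loop `loopPAt σ σ′`
  (node 8's `skew_axial_grad`, `skew_segUp_grad` pulled back along the coordinate permutation — the Ward lemma is
  additive over path pieces, so no global transport of the pair loop is needed);
* §2 the generic functionals `symZ ρ` (`= symLinU ρ` on rings, `rfl`), `symSkewHessAt β ρ`, `symSkewVHAt β ρ`, the
  pair-sum reductions `Σ_x Σ_{σ,σ′} X(γ^{σ,σ′}_x) = d!·S(X)`, `Σ_x Σ_{σ,σ′} X(loop^{σ,σ′}_x) = d!·S(X) − (d!)²L^d·X(c)`,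
  additivity in both forms and the swap law.
The four Ward identities, the bridges to the (0.4) counts, the divergence law (K-V2)sym and the stencil law (S-V)⁰⁴ for
`symVhSAt` built on these are in the sibling leaf `SymAveragingWardRootedStencils`.

WHAT IS NOT PROVED / NOT CLAIMED: nothing printed ([Balaban1987RG1] (0.4) is a locator for which words are summed, B7 (11)
is NOT asserted); nothing about logarithms / `Φ_b`, `wilsonA`, `KInv`, (W1′)/(W2′), the socket, (R1), (K1·), row D1's
numerical letters, `BetaPertH`, continuum, Clay.

Provenance: cell pub-balaban, β sub-cell, lineage an1, gen 42 (2026-08-21); over an1 gen 41's `SymAveragingHessianCounts`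
(words and counts, BY NAME) and node 8 (`AveragingWardJets`: `skew`, `midF`, path Ward lemmas, BY NAME); the proofs are
the node-8ρ proofs (`AveragingWardRooted`, an1 gen 23) transcribed to pair words; no existing file touched.
Bib keys (locators only): Balaban1985Averaging, Balaban1987RG1.
-/

open Finset
open scoped BigOperators Nat
open Literature.MathematicalPhysics.QuantumFieldTheory.Balaban1983to89
open Literature.MathematicalPhysics.QuantumFieldTheory.Balaban1983to89.Beta
open AffineAveraging AveragingContours TransportedContourVariables AveragingHessianKernels AveragingWardJets
  AveragingContoursRooted AveragingHessianKernelsRooted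
open Summit.QuantumFields.BalabanUV.Beta.KernelPermutation (psite psite_apply psite_symm_apply psite_add psite_sub psite_smul)
open Summit.QuantumFields.BalabanUV.Beta.ResolventPermutation (psite_unitVec)
open Summit.QuantumFields.BalabanUV.Beta.SymmetrisedAxialPotential (card_perm_fin)
open Summit.QuantumFields.BalabanUV.Beta.SymAveragingHessianCounts

namespace Summit.QuantumFields.BalabanUV.Beta.SymAveragingWardRooted

/-! ## §1 Path Ward lemmas for the permuted comb and the pair words -/

section PathWard

variable {d : ℕ} {A V : Type*} [AddCommGroup A] [AddCommGroup V] (β : A →+ A →+ V)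

/-- [folklore] The pull-back of the mid-point form is the mid-point form of the pulled-back data. -/
theorem P1g_midF (σ : Equiv.Perm (Fin d)) (lam : (Fin d → ℤ) → A) (B : Form1 d A) :
    P1g σ (midF β lam B) = midF β (fun x => lam (psite σ x)) (P1g σ B) := by
  funext κ x
  simp only [P1g_apply, midF_apply, psite_add, psite_unitVec]

/-- [folklore] First letters of the pair form along a permuted comb. -/
@[simp] theorem bg_axialP_pairForm (σ : Equiv.Perm (Fin d)) (X B : Form1 d A) (y x : Fin d → ℤ) :
    bg (axialP σ (pairForm X B) y x) = axialP σ X y x := by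
  simp only [axialP, P1g_pairForm, bg_axial_pairForm]

/-- [folklore] Second letters of the pair form along a permuted comb. -/
@[simp] theorem fl_axialP_pairForm (σ : Equiv.Perm (Fin d)) (X B : Form1 d A) (y x : Fin d → ℤ) :
    fl (axialP σ (pairForm X B) y x) = axialP σ B y x := by
  simp only [axialP, P1g_pairForm, fl_axial_pairForm]

/-- [folklore] PATH WARD LEMMA along the permuted comb `Γ^σ_{y,x}` (node 8 `skew_axial_grad` pulled back along `σ`):
`skew β (grad λ, B) = Σ midF − β (λ y + λ x) (Σ B)`. -/
theorem skew_axialP_grad (σ : Equiv.Perm (Fin d)) (lam : (Fin d → ℤ) → A) (B : Form1 d A) (y x : Fin d → ℤ) :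
    skew β (axialP σ (pairForm (grad lam) B) y x)
      = (axialP σ (midF β lam B) y x).sum - β (lam y + lam x) (axialP σ B y x).sum := by
  simp only [axialP, P1g_pairForm, P1g_grad, skew_axial_grad, P1g_midF, Equiv.apply_symm_apply]

/-- [folklore] First letters of the pair form along a pair word. -/
theorem bg_gammaPAt_pairForm (σ σ' : Equiv.Perm (Fin d)) (ρ : Fin d → ℤ) (X B : Form1 d A) (L : ℕ) (μ : Fin d)
    (y : Fin d → ℤ) (b : Fin d → ℕ) : bg (gammaPAt σ σ' ρ (pairForm X B) L μ y b) = gammaPAt σ σ' ρ X L μ y b := by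
  change List.map Prod.fst _ = _
  rw [← AddMonoidHom.coe_fst, gammaPAt_map, mapForm_fst_pairForm]

/-- [folklore] Second letters of the pair form along a pair word. -/
theorem fl_gammaPAt_pairForm (σ σ' : Equiv.Perm (Fin d)) (ρ : Fin d → ℤ) (X B : Form1 d A) (L : ℕ) (μ : Fin d)
    (y : Fin d → ℤ) (b : Fin d → ℕ) : fl (gammaPAt σ σ' ρ (pairForm X B) L μ y b) = gammaPAt σ σ' ρ B L μ y b := by
  change List.map Prod.snd _ = _
  rw [← AddMonoidHom.coe_snd, gammaPAt_map, mapForm_snd_pairForm]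

/-- [folklore] PATH WARD LEMMA along the pair word `γ^{σ,σ′}_x` from the root `r = L·y + ρ` to `r + L·e_μ`:
`skew β (grad λ, B) = Σ midF − β (λ r + λ (r + L e_μ)) (Σ B)`. -/
theorem skew_gammaPAt_grad (σ σ' : Equiv.Perm (Fin d)) (ρ : Fin d → ℤ) (lam : (Fin d → ℤ) → A) (B : Form1 d A) (L : ℕ)
    (μ : Fin d) (y : Fin d → ℤ) (b : Fin d → ℕ) :
    skew β (gammaPAt σ σ' ρ (pairForm (grad lam) B) L μ y b)
      = (gammaPAt σ σ' ρ (midF β lam B) L μ y b).sum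
        - β (lam ((L : ℤ) • y + ρ) + lam ((L : ℤ) • y + ρ + (L : ℤ) • unitVec μ)) (gammaPAt σ σ' ρ B L μ y b).sum := by
  simp only [gammaPAt, skew_append, skew_rev, skew_axialP_grad, skew_segUp_grad, bg_append, fl_append, bg_rev, fl_rev,
    rev_sum, List.sum_append, bg_axialP_pairForm, fl_axialP_pairForm, bg_segUp_pairForm, fl_segUp_pairForm,
    axialP_sum_grad, segUp_sum_grad, map_add, map_sub, map_neg, AddMonoidHom.add_apply, AddMonoidHom.sub_apply,
    AddMonoidHom.neg_apply]
  abel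

/-- [folklore] PATH WARD LEMMA around the closed pair loop: `skew β (grad λ, B) = Σ_loop midF − β (2 λ r) (Σ_loop B)`. -/
theorem skew_loopPAt_grad (σ σ' : Equiv.Perm (Fin d)) (ρ : Fin d → ℤ) (lam : (Fin d → ℤ) → A) (B : Form1 d A) (L : ℕ)
    (μ : Fin d) (y : Fin d → ℤ) (b : Fin d → ℕ) :
    skew β (loopPAt σ σ' ρ (pairForm (grad lam) B) L μ y b)
      = (loopPAt σ σ' ρ (midF β lam B) L μ y b).sum
        - β (lam ((L : ℤ) • y + ρ) + lam ((L : ℤ) • y + ρ)) (loopPAt σ σ' ρ B L μ y b).sum := by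
  simp only [loopPAt, skew_append, skew_rev, skew_gammaPAt_grad, skew_segUp_grad, bg_rev, fl_rev, rev_sum,
    List.sum_append, bg_gammaPAt_pairForm, fl_gammaPAt_pairForm, bg_segUp_pairForm, fl_segUp_pairForm,
    gammaPAt_sum_grad, segUp_sum_grad, map_add, map_sub, map_neg, AddMonoidHom.add_apply, AddMonoidHom.sub_apply,
    AddMonoidHom.neg_apply]
  abel

/-- [folklore] Linearity of the pair-word sum in the form (differences). -/
theorem gammaPAt_sum_sub (σ σ' : Equiv.Perm (Fin d)) (ρ : Fin d → ℤ) (X X' : Form1 d A) (L : ℕ) (μ : Fin d)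
    (y : Fin d → ℤ) (b : Fin d → ℕ) :
    (gammaPAt σ σ' ρ (X - X') L μ y b).sum = (gammaPAt σ σ' ρ X L μ y b).sum - (gammaPAt σ σ' ρ X' L μ y b).sum := by
  simp only [gammaPAt, List.sum_append, rev_sum, axialP_sum_sub, segUp_sum_sub]
  abel

end PathWard

/-! ## §2 The generic symmetrised functionals `symZ ρ`, `symSkewHessAt β ρ`, `symSkewVHAt β ρ` -/

section Functional

variable {d : ℕ} {A V : Type*} [AddCommGroup A] [AddCommGroup V] (β : A →+ A →+ V)

/-- [our object] THE GENERIC SYMMETRISED LINEAR FUNCTIONAL `S(X) = Σ_σ Σ_{x ∈ B(y)} X(γ^{σ,σ}_x)` on any additive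
group of letters (`symLinU ρ` is the ring instance, `symZ_eq_symLinU`). -/
def symZ (ρ : Fin d → ℤ) (X : Form1 d A) (L : ℕ) (μ : Fin d) (y : Fin d → ℤ) : A :=
  ∑ σ : Equiv.Perm (Fin d), ∑ b ∈ box d L, (gammaPAt σ σ ρ X L μ y b).sum

/-- [folklore] BRIDGE: on a ring `symZ ρ = symLinU ρ` (`rfl`). -/
theorem symZ_eq_symLinU {𝔸 : Type*} [Ring 𝔸] (ρ : Fin d → ℤ) (W : Form1 d 𝔸) (L : ℕ) (μ : Fin d) (y : Fin d → ℤ) :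
    symZ ρ W L μ y = symLinU ρ W L μ y := rfl

/-- [our object] THE GENERIC SYMMETRISED SECOND-ORDER FUNCTIONAL of a biadditive pairing `β` (weight `(d!)²`):
`Σ_x Σ_{σ,σ′} skew(loop^{σ,σ′}_x) + d!·(β (S X) (X′ c) − β (X c) (S X′)) + (d!)²·L^d·skew(c)` with the straight coarse
bond `c` FROM THE ROOT (`symHessCountAt ρ` is the instance `β = (·*·)` at indicators, `symHessCountAt_eq_symSkewHessAt`). -/
def symSkewHessAt (ρ : Fin d → ℤ) (X X' : Form1 d A) (L : ℕ) (μ : Fin d) (y : Fin d → ℤ) : V :=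
  (∑ b ∈ box d L, ∑ σ : Equiv.Perm (Fin d), ∑ σ' : Equiv.Perm (Fin d), skew β (loopPAt σ σ' ρ (pairForm X X') L μ y b))
    + (d ! : ℤ) • (β (symZ ρ X L μ y) (segUp X' ((L : ℤ) • y + ρ) μ L).sum
        - β (segUp X ((L : ℤ) • y + ρ) μ L).sum (symZ ρ X' L μ y))
    + ((d ! : ℤ) ^ 2 * (L : ℤ) ^ d) • skew β (segUp (pairForm X X') ((L : ℤ) • y + ρ) μ L)

/-- [our object] THE GENERIC SYMMETRISED PRODUCT-CHART FUNCTIONAL (`symVhCountAt ρ` is the instance `β = (·*·)`,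
`symVhCountAt_eq_symSkewVHAt`): `L^d • symSkewHessAt + (d!·L^d) • S (ptF β X X′) − β (S X) (S X′)`. -/
def symSkewVHAt (ρ : Fin d → ℤ) (X X' : Form1 d A) (L : ℕ) (μ : Fin d) (y : Fin d → ℤ) : V :=
  ((L : ℤ) ^ d) • symSkewHessAt β ρ X X' L μ y + ((d ! : ℤ) * (L : ℤ) ^ d) • symZ ρ (ptF β X X') L μ y
    - β (symZ ρ X L μ y) (symZ ρ X' L μ y)

/-- [folklore] `symZ ρ` is additive in the form (differences). -/
theorem symZ_sub (ρ : Fin d → ℤ) (X X' : Form1 d A) (L : ℕ) (μ : Fin d) (y : Fin d → ℤ) :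
    symZ ρ (X - X') L μ y = symZ ρ X L μ y - symZ ρ X' L μ y := by
  simp only [symZ, gammaPAt_sum_sub, Finset.sum_sub_distrib]

/-- [folklore] `symZ ρ 0 = 0`. -/
theorem symZ_zeroForm (ρ : Fin d → ℤ) (L : ℕ) (μ : Fin d) (y : Fin d → ℤ) : symZ ρ (0 : Form1 d A) L μ y = 0 := by
  simpa using symZ_sub ρ (0 : Form1 d A) 0 L μ y

/-- [folklore] `symZ ρ` is additive in the form (sums). -/
theorem symZ_addForm (ρ : Fin d → ℤ) (X X' : Form1 d A) (L : ℕ) (μ : Fin d) (y : Fin d → ℤ) :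
    symZ ρ (X + X') L μ y = symZ ρ X L μ y + symZ ρ X' L μ y := by
  have h := symZ_sub ρ (X + X') X' L μ y
  rw [add_sub_cancel_right] at h
  rw [h]; abel

/-- [folklore] `symZ ρ` of an exact form: `S(grad f) = d!·L^d·(f (r + L e_μ) − f r)`. -/
theorem symZ_grad (ρ : Fin d → ℤ) (f : (Fin d → ℤ) → A) (L : ℕ) (μ : Fin d) (y : Fin d → ℤ) :
    symZ ρ (grad f) L μ y
      = ((d ! : ℤ) * (L : ℤ) ^ d) • (f ((L : ℤ) • y + ρ + (L : ℤ) • unitVec μ) - f ((L : ℤ) • y + ρ)) := by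
  have hcard : (box d L).card = L ^ d := by simp [AffineAveraging.box, Fintype.card_piFinset]
  simp only [symZ, gammaPAt_sum_grad, Finset.sum_const, Finset.card_univ, card_perm_fin, hcard, smul_smul,
    ← natCast_zsmul, Nat.cast_pow]

/-- [folklore] The triple sum `Σ_x Σ_σ Σ_σ′` of a summand `a σ x + s x − u σ′ x` is `d! • Σ_σ Σ_x (a σ x + s x − u σ x)`. -/
theorem sum_pair_aux (a u : Equiv.Perm (Fin d) → (Fin d → ℕ) → A) (s : (Fin d → ℕ) → A) (L : ℕ) :
    ∑ b ∈ box d L, ∑ σ : Equiv.Perm (Fin d), ∑ σ' : Equiv.Perm (Fin d), (a σ b + s b - u σ' b)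
      = (d ! : ℤ) • ∑ σ : Equiv.Perm (Fin d), ∑ b ∈ box d L, (a σ b + s b - u σ b) := by
  conv_rhs => rw [Finset.sum_comm]
  simp only [Finset.sum_add_distrib, Finset.sum_sub_distrib, Finset.sum_const, Finset.card_univ, card_perm_fin,
    Finset.smul_sum, smul_add, smul_sub, ← natCast_zsmul]

/-- [folklore] `Σ_x Σ_{σ,σ′} X(γ^{σ,σ′}_x) = d! • S(X)` (at linear order the two comb orders decouple). -/
theorem sum_pair_gammaPAt_sum (ρ : Fin d → ℤ) (X : Form1 d A) (L : ℕ) (μ : Fin d) (y : Fin d → ℤ) :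
    ∑ b ∈ box d L, ∑ σ : Equiv.Perm (Fin d), ∑ σ' : Equiv.Perm (Fin d), (gammaPAt σ σ' ρ X L μ y b).sum
      = (d ! : ℤ) • symZ ρ X L μ y := by
  have key := sum_pair_aux (fun σ b => (axialP σ X ((L : ℤ) • y + ρ) ((L : ℤ) • y + toSite b)).sum)
    (fun σ' b => (axialP σ' X ((L : ℤ) • y + ρ + (L : ℤ) • unitVec μ) ((L : ℤ) • y + toSite b + (L : ℤ) • unitVec μ)).sum)
    (fun b => (segUp X ((L : ℤ) • y + toSite b) μ L).sum) L
  simpa only [symZ, gammaPAt, List.sum_append, rev_sum, sub_eq_add_neg] using key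

/-- [folklore] `Σ_x Σ_{σ,σ′} X(loop^{σ,σ′}_x) = d! • S(X) − ((d!)²·L^d) • X(c)` with the coarse bond from the root. -/
theorem sum_pair_loopPAt_sum (ρ : Fin d → ℤ) (X : Form1 d A) (L : ℕ) (μ : Fin d) (y : Fin d → ℤ) :
    ∑ b ∈ box d L, ∑ σ : Equiv.Perm (Fin d), ∑ σ' : Equiv.Perm (Fin d), (loopPAt σ σ' ρ X L μ y b).sum
      = (d ! : ℤ) • symZ ρ X L μ y - ((d ! : ℤ) ^ 2 * (L : ℤ) ^ d) • (segUp X ((L : ℤ) • y + ρ) μ L).sum := by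
  have hcard : (box d L).card = L ^ d := by simp [AffineAveraging.box, Fintype.card_piFinset]
  simp only [loopPAt, List.sum_append, rev_sum, Finset.sum_add_distrib, Finset.sum_neg_distrib, sum_pair_gammaPAt_sum,
    Finset.sum_const, Finset.card_univ, card_perm_fin, hcard, smul_smul, ← natCast_zsmul, Nat.cast_pow]
  module

/-- [folklore] ADDITIVITY of the pair-loop `skew` in the first form. -/
theorem skew_loopPAt_add_left (σ σ' : Equiv.Perm (Fin d)) (ρ : Fin d → ℤ) (X₁ X₂ X' : Form1 d A) (L : ℕ) (μ : Fin d)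
    (y : Fin d → ℤ) (b : Fin d → ℕ) :
    skew β (loopPAt σ σ' ρ (pairForm (X₁ + X₂) X') L μ y b)
      = skew β (loopPAt σ σ' ρ (pairForm X₁ X') L μ y b) + skew β (loopPAt σ σ' ρ (pairForm X₂ X') L μ y b) := by
  have e : ∀ w : A × A →+ A, pairForm (fun κ x => w (X₁ κ x, X₂ κ x)) X'
      = mapForm (w.prodMap (AddMonoidHom.fst A A)) (pairForm (pairForm X₁ X₂) (pairForm X' X')) := by
    intro w; funext κ x; simp
  have c : ∀ w : A × A →+ A,
      (loopPAt σ σ' ρ (pairForm (pairForm X₁ X₂) (pairForm X' X')) L μ y b).map ⇑(w.prodMap (AddMonoidHom.fst A A))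
        = (loopPAt σ σ' ρ (pairForm (pairForm X₁ X₂) (pairForm X' X')) L μ y b).map fun t => (w t.1, t.2.1) := by
    intro w; apply List.map_congr_left; intro t _; rfl
  have h₀ : pairForm (X₁ + X₂) X'
      = pairForm (fun κ x => (AddMonoidHom.fst A A + AddMonoidHom.snd A A) (X₁ κ x, X₂ κ x)) X' := by
    funext κ x; simp
  have h₁ : pairForm X₁ X' = pairForm (fun κ x => (AddMonoidHom.fst A A) (X₁ κ x, X₂ κ x)) X' := by
    funext κ x; simp
  have h₂ : pairForm X₂ X' = pairForm (fun κ x => (AddMonoidHom.snd A A) (X₁ κ x, X₂ κ x)) X' := by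
    funext κ x; simp
  rw [h₀, h₁, h₂, e, e, e, ← loopPAt_map, ← loopPAt_map, ← loopPAt_map, c, c, c]
  simpa using skew_map_add_fst β (fun q : A × A => q.1) (fun q : A × A => q.2) (fun q : A × A => q.1)
    (loopPAt σ σ' ρ (pairForm (pairForm X₁ X₂) (pairForm X' X')) L μ y b)

/-- [folklore] ADDITIVITY of `symSkewHessAt β ρ` in the first form. -/
theorem symSkewHessAt_add_left (ρ : Fin d → ℤ) (X₁ X₂ X' : Form1 d A) (L : ℕ) (μ : Fin d) (y : Fin d → ℤ) :
    symSkewHessAt β ρ (X₁ + X₂) X' L μ y = symSkewHessAt β ρ X₁ X' L μ y + symSkewHessAt β ρ X₂ X' L μ y := by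
  simp only [symSkewHessAt, skew_loopPAt_add_left, Finset.sum_add_distrib, symZ_addForm, segUp_sum_addForm,
    skew_segUp_add_left, map_add, AddMonoidHom.add_apply, smul_add, smul_sub]
  abel

/-- [folklore] Swapping the pair form swaps the letters of the pair loops (any additive group of letters). -/
theorem loopPAt_pairForm_swap' (σ σ' : Equiv.Perm (Fin d)) (ρ : Fin d → ℤ) (X X' : Form1 d A) (L : ℕ) (μ : Fin d)
    (y : Fin d → ℤ) (b : Fin d → ℕ) :
    loopPAt σ σ' ρ (pairForm X' X) L μ y b = (loopPAt σ σ' ρ (pairForm X X') L μ y b).map Prod.swap := by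
  have hp : pairForm X' X = mapForm (AddEquiv.prodComm : A × A ≃+ A × A).toAddMonoidHom (pairForm X X') := by
    funext κ x; rfl
  rw [hp, ← loopPAt_map]; rfl

/-- [folklore] SWAP LAW: `symSkewHessAt β ρ X′ X = − symSkewHessAt β.flip ρ X X′`. -/
theorem symSkewHessAt_swap (ρ : Fin d → ℤ) (X X' : Form1 d A) (L : ℕ) (μ : Fin d) (y : Fin d → ℤ) :
    symSkewHessAt β ρ X' X L μ y = -symSkewHessAt β.flip ρ X X' L μ y := by
  have hs : segUp (pairForm X' X) ((L : ℤ) • y + ρ) μ L = (segUp (pairForm X X') ((L : ℤ) • y + ρ) μ L).map Prod.swap := by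
    have hp : pairForm X' X = mapForm (AddEquiv.prodComm : A × A ≃+ A × A).toAddMonoidHom (pairForm X X') := by
      funext κ x; rfl
    rw [hp, ← segUp_map]; rfl
  have hl : ∀ (b : Fin d → ℕ) (σ σ' : Equiv.Perm (Fin d)),
      loopPAt σ σ' ρ (pairForm X' X) L μ y b = (loopPAt σ σ' ρ (pairForm X X') L μ y b).map Prod.swap :=
    fun b σ σ' => loopPAt_pairForm_swap' σ σ' ρ X X' L μ y b
  simp only [symSkewHessAt, hl, hs, skew_swap, Finset.sum_neg_distrib, AddMonoidHom.flip_apply, smul_neg, smul_sub,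
    neg_add, neg_sub]

/-- [folklore] `symSkewHessAt β ρ 0 X′ = 0`. -/
theorem symSkewHessAt_zero_left (ρ : Fin d → ℤ) (X' : Form1 d A) (L : ℕ) (μ : Fin d) (y : Fin d → ℤ) :
    symSkewHessAt β ρ 0 X' L μ y = 0 := by
  have h := symSkewHessAt_add_left β ρ (0 : Form1 d A) 0 X' L μ y
  rw [add_zero] at h
  exact left_eq_add.mp h

/-- [folklore] `symSkewHessAt β ρ` respects differences in the first form. -/
theorem symSkewHessAt_sub_left (ρ : Fin d → ℤ) (X₁ X₂ X' : Form1 d A) (L : ℕ) (μ : Fin d) (y : Fin d → ℤ) :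
    symSkewHessAt β ρ (X₁ - X₂) X' L μ y = symSkewHessAt β ρ X₁ X' L μ y - symSkewHessAt β ρ X₂ X' L μ y := by
  have h := symSkewHessAt_add_left β ρ (X₁ - X₂) X₂ X' L μ y
  rw [sub_add_cancel] at h
  rw [h]; abel

/-- [folklore] `symSkewHessAt β ρ` commutes with finite sums in the first form. -/
theorem symSkewHessAt_sum_left {ι : Type*} (s : Finset ι) (ρ : Fin d → ℤ) (X : ι → Form1 d A) (X' : Form1 d A) (L : ℕ)
    (μ : Fin d) (y : Fin d → ℤ) :
    symSkewHessAt β ρ (∑ i ∈ s, X i) X' L μ y = ∑ i ∈ s, symSkewHessAt β ρ (X i) X' L μ y := by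
  classical
  induction s using Finset.induction_on with
  | empty => simp [symSkewHessAt_zero_left]
  | insert i s hi ih => rw [Finset.sum_insert hi, Finset.sum_insert hi, symSkewHessAt_add_left, ih]

/-- [folklore] ADDITIVITY of `symSkewHessAt β ρ` in the second form (by the swap law). -/
theorem symSkewHessAt_add_right (ρ : Fin d → ℤ) (X X₁ X₂ : Form1 d A) (L : ℕ) (μ : Fin d) (y : Fin d → ℤ) :
    symSkewHessAt β ρ X (X₁ + X₂) L μ y = symSkewHessAt β ρ X X₁ L μ y + symSkewHessAt β ρ X X₂ L μ y := by
  rw [symSkewHessAt_swap β, symSkewHessAt_swap β ρ X₁, symSkewHessAt_swap β ρ X₂, symSkewHessAt_add_left]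
  abel

/-- [folklore] `symSkewHessAt β ρ X 0 = 0`. -/
theorem symSkewHessAt_zero_right (ρ : Fin d → ℤ) (X : Form1 d A) (L : ℕ) (μ : Fin d) (y : Fin d → ℤ) :
    symSkewHessAt β ρ X 0 L μ y = 0 := by
  rw [symSkewHessAt_swap β, symSkewHessAt_zero_left, neg_zero]

/-- [folklore] `symSkewHessAt β ρ` respects differences in the second form. -/
theorem symSkewHessAt_sub_right (ρ : Fin d → ℤ) (X X₁ X₂ : Form1 d A) (L : ℕ) (μ : Fin d) (y : Fin d → ℤ) :
    symSkewHessAt β ρ X (X₁ - X₂) L μ y = symSkewHessAt β ρ X X₁ L μ y - symSkewHessAt β ρ X X₂ L μ y := by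
  have h := symSkewHessAt_add_right β ρ X (X₁ - X₂) X₂ L μ y
  rw [sub_add_cancel] at h
  rw [h]; abel

/-- [folklore] `symSkewHessAt β ρ` commutes with finite sums in the second form. -/
theorem symSkewHessAt_sum_right {ι : Type*} (s : Finset ι) (ρ : Fin d → ℤ) (X : Form1 d A) (X' : ι → Form1 d A) (L : ℕ)
    (μ : Fin d) (y : Fin d → ℤ) :
    symSkewHessAt β ρ X (∑ i ∈ s, X' i) L μ y = ∑ i ∈ s, symSkewHessAt β ρ X (X' i) L μ y := by
  classical
  induction s using Finset.induction_on with
  | empty => simp [symSkewHessAt_zero_right]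
  | insert i s hi ih => rw [Finset.sum_insert hi, Finset.sum_insert hi, symSkewHessAt_add_right, ih]

/-- [folklore] `ptF β` is additive in the first form. -/
theorem ptF_add_left' (X₁ X₂ X' : Form1 d A) : ptF β (X₁ + X₂) X' = ptF β X₁ X' + ptF β X₂ X' := by
  funext κ x; simp

/-- [folklore] `ptF β` is additive in the second form. -/
theorem ptF_add_right' (X X₁ X₂ : Form1 d A) : ptF β X (X₁ + X₂) = ptF β X X₁ + ptF β X X₂ := by
  funext κ x; simp

/-- [folklore] ADDITIVITY of `symSkewVHAt β ρ` in the first form. -/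
theorem symSkewVHAt_add_left (ρ : Fin d → ℤ) (X₁ X₂ X' : Form1 d A) (L : ℕ) (μ : Fin d) (y : Fin d → ℤ) :
    symSkewVHAt β ρ (X₁ + X₂) X' L μ y = symSkewVHAt β ρ X₁ X' L μ y + symSkewVHAt β ρ X₂ X' L μ y := by
  simp only [symSkewVHAt, symSkewHessAt_add_left, ptF_add_left', symZ_addForm, map_add, AddMonoidHom.add_apply, smul_add]
  abel

/-- [folklore] ADDITIVITY of `symSkewVHAt β ρ` in the second form. -/
theorem symSkewVHAt_add_right (ρ : Fin d → ℤ) (X X₁ X₂ : Form1 d A) (L : ℕ) (μ : Fin d) (y : Fin d → ℤ) :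
    symSkewVHAt β ρ X (X₁ + X₂) L μ y = symSkewVHAt β ρ X X₁ L μ y + symSkewVHAt β ρ X X₂ L μ y := by
  simp only [symSkewVHAt, symSkewHessAt_add_right, ptF_add_right', symZ_addForm, map_add, smul_add]
  abel

/-- [folklore] `symSkewVHAt β ρ 0 X′ = 0`. -/
theorem symSkewVHAt_zero_left (ρ : Fin d → ℤ) (X' : Form1 d A) (L : ℕ) (μ : Fin d) (y : Fin d → ℤ) :
    symSkewVHAt β ρ 0 X' L μ y = 0 := by
  have h := symSkewVHAt_add_left β ρ (0 : Form1 d A) 0 X' L μ y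
  rw [add_zero] at h
  exact left_eq_add.mp h

/-- [folklore] `symSkewVHAt β ρ X 0 = 0`. -/
theorem symSkewVHAt_zero_right (ρ : Fin d → ℤ) (X : Form1 d A) (L : ℕ) (μ : Fin d) (y : Fin d → ℤ) :
    symSkewVHAt β ρ X 0 L μ y = 0 := by
  have h := symSkewVHAt_add_right β ρ X (0 : Form1 d A) 0 L μ y
  rw [add_zero] at h
  exact left_eq_add.mp h

/-- [folklore] `symSkewVHAt β ρ` respects differences in the first form. -/
theorem symSkewVHAt_sub_left (ρ : Fin d → ℤ) (X₁ X₂ X' : Form1 d A) (L : ℕ) (μ : Fin d) (y : Fin d → ℤ) :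
    symSkewVHAt β ρ (X₁ - X₂) X' L μ y = symSkewVHAt β ρ X₁ X' L μ y - symSkewVHAt β ρ X₂ X' L μ y := by
  have h := symSkewVHAt_add_left β ρ (X₁ - X₂) X₂ X' L μ y
  rw [sub_add_cancel] at h
  rw [h]; abel

/-- [folklore] `symSkewVHAt β ρ` respects differences in the second form. -/
theorem symSkewVHAt_sub_right (ρ : Fin d → ℤ) (X X₁ X₂ : Form1 d A) (L : ℕ) (μ : Fin d) (y : Fin d → ℤ) :
    symSkewVHAt β ρ X (X₁ - X₂) L μ y = symSkewVHAt β ρ X X₁ L μ y - symSkewVHAt β ρ X X₂ L μ y := by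
  have h := symSkewVHAt_add_right β ρ X (X₁ - X₂) X₂ L μ y
  rw [sub_add_cancel] at h
  rw [h]; abel

/-- [folklore] `symSkewVHAt β ρ` commutes with finite sums in the first form. -/
theorem symSkewVHAt_sum_left {ι : Type*} (s : Finset ι) (ρ : Fin d → ℤ) (X : ι → Form1 d A) (X' : Form1 d A) (L : ℕ)
    (μ : Fin d) (y : Fin d → ℤ) :
    symSkewVHAt β ρ (∑ i ∈ s, X i) X' L μ y = ∑ i ∈ s, symSkewVHAt β ρ (X i) X' L μ y := by
  classical
  induction s using Finset.induction_on with
  | empty => simp [symSkewVHAt_zero_left]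
  | insert i s hi ih => rw [Finset.sum_insert hi, Finset.sum_insert hi, symSkewVHAt_add_left, ih]

/-- [folklore] `symSkewVHAt β ρ` commutes with finite sums in the second form. -/
theorem symSkewVHAt_sum_right {ι : Type*} (s : Finset ι) (ρ : Fin d → ℤ) (X : Form1 d A) (X' : ι → Form1 d A) (L : ℕ)
    (μ : Fin d) (y : Fin d → ℤ) :
    symSkewVHAt β ρ X (∑ i ∈ s, X' i) L μ y = ∑ i ∈ s, symSkewVHAt β ρ X (X' i) L μ y := by
  classical
  induction s using Finset.induction_on with
  | empty => simp [symSkewVHAt_zero_right]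
  | insert i s hi ih => rw [Finset.sum_insert hi, Finset.sum_insert hi, symSkewVHAt_add_right, ih]

end Functional

end Summit.QuantumFields.BalabanUV.Beta.SymAveragingWardRooted
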